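import Mathlib
import Literature.Probability.MarkovChains.MetropolisHastings
import Literature.Probability.MarkovChains.TotalVariation
import Literature.Probability.Entropy.BinaryRelativeEntropy
import Summits.Ventures.LatticeQCDFlow.Exactness.FlowMCMC
import Summits.Ventures.LatticeQCDFlow.Scaling.ImportanceWeights
import Summits.Ventures.LatticeQCDFlow.Scaling.SectorBudget
import Summits.Ventures.LatticeQCDFlow.Scaling.BlockDefect
import Summits.Ventures.LatticeQCDFlow.Scaling.IMHVolumeLaw
import Summits.Ventures.LatticeQCDFlow.Scaling.StochasticBudgets
import Summits.Ventures.LatticeQCDFlow.Scaling.VarianceLaws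
import Summits.Ventures.LatticeQCDFlow.Scaling.Acceptance
import Summits.Ventures.LatticeQCDFlow.Scaling.SectorPrices
import Summits.Ventures.LatticeQCDFlow.Scaling.ReceptiveField

/-!
# LatticeQCDFlow / Scaling — barrier-catalogue SUPPLEMENTS (v1.6): acceptance blindness, the
# reverse-KL exchange rate, the receptive-field law, the relaxation-time volume law

HONEST FRAMING: exact (Metropolis-corrected) sampling algorithms for lattice gauge theory;
figures of merit are autocorrelation/cost numbers at stated couplings and volumes; no
continuum-physics claim.

Venture `LatticeQCDFlow` (cell pub-lqcd).  Companion of `Scaling/Barriers.lean` (the four T4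
entries B1–B4 of record + the v1.4 supplements) and `Scaling/BarriersStochastic.lean` (v1.5):
the four v1.6 supplements of HOME/THEORY-2-Sketch.lean (theory seat, FANOUT row 29; THEORY-2.md
§5.7), in the same barrier-docstring format, each a `def … : Prop` whose body is the PROVED
finite core (`Scaling/{Acceptance, SectorPrices, ReceptiveField, IMHVolumeLaw}.lean`) and each
DISCHARGED by a theorem:

* `AcceptanceBlindness` (cite under ExactnessVsExpressivity §5.3 / TopologicalModeCollapse §5.2)
  — `acc = 1 − ‖p⊗q − q⊗p‖_TV`, mixtures keep `acc ≥ 1 − θ` at every volume while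
  `ESS ≤ θ⁻² Π ESS_block`: `acceptanceBlindness`;
* `ReverseKLModeSeeking` (TopologicalModeCollapse §5.2) — dropping a sector of mass `a` costs the
  reverse-KL trainer `≤ −log(1−a)` nats and the sampler `ESS ≤ ε/a²`: `reverseKLModeSeeking`;
* `ReceptiveFieldLaw` (VolumeScalingOfTraining §5.1) — `s ≥ (ξ/2) log(2mκ²/log(1/η))` under the
  typed clustering floor: `receptiveFieldLaw`;
* `RelaxationVolumeLaw` (VolumeScalingOfTraining §5.1) — worst-start relaxation time
  `≳ Π_blocks W_i` (re-based on row 31's `IMHVolumeLaw`: exact rate `imh_blockProd_tvDist_mode`,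
  mixing-time form `imh_blockProd_mixing_time_ge`): `relaxationVolumeLaw`.
OUR results (LEAN PLACEMENT RULE: under the Venture, not `Literature/Barriers/`); the printed
laws live in the docstrings.  The four barrier `def`s of record are unchanged; `ReceptiveFieldLaw`'s
physics input is the typed conjecture `Conjectures.ClusteringFloor` (U″), never a Literature fact.
-/

namespace Summit.Ventures.LatticeQCDFlow.Barriers

open Finset

/-! ### v1.6 (gen-5) supplements — acceptance blindness, the reverse-KL exchange rate, the
receptive-field `log V` law, the relaxation-time volume law (PROVED; cite under
VolumeScalingOfTraining §5.1 (receptive field, relaxation), TopologicalModeCollapse §5.2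
(reverse-KL incentive, acceptance), ExactnessVsExpressivity §5.3 (acceptance)).  The four barrier
`def`s of record are unchanged; `ReceptiveFieldLaw`'s physics input is the typed conjecture
`Conjectures.ClusteringFloor` (U″), never a Literature fact. -/

/-- **Supplement (AcceptanceBlindness) to ExactnessVsExpressivity / TopologicalModeCollapse — the
mean acceptance is a total variation and certifies nothing about volume scaling or sectors.**
`acc(p,q) = 1 − ‖p⊗q − q⊗p‖_TV ∈ [1 − 2‖p−q‖_TV, 1 − ‖p−q‖_TV]`; for the volume family "target =
`(1−θ)·model + θ·(anything product)`" the acceptance is `≥ 1 − θ` at every volume while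
`ESS ≤ θ⁻² Π_blocks ESS_block`.  E.g. `θ = 0.2`, `100` blocks with `ESS_block(r_i, q_i) = 0.9`:
`acc ≥ 0.8` for all volumes, `ESS ≤ 25 · 0.9^{100} < 7·10⁻⁴`.  The one-sided converse DOES hold:
`(2·TV)² ≤ χ² = 1/ESS − 1`, so `acc ≥ 1 − √(1/ESS − 1)` (ESS `0.8` forces acceptance `≥ 0.5`,
`0.99` forces `≥ 0.899`) — ESS floors acceptance, acceptance never floors ESS.
technique_class: any lane (deterministic or stochastic flow, any architecture) that reports mean
  acceptance as its figure of merit or as evidence of volume transfer / ergodicity.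
blocks: "acceptance stays at x% from L = 8 to L = 16, hence the model transfers in volume";
  acceptance-based pass criteria; acceptance as a proxy for τ_int(Q) (use T2-R / V8–V9 instead).
because: PROVED `Theory2.accRate_eq_one_sub_tvDist_prodLaw`,
  `Theory2.one_sub_two_tvDist_le_accRate`, `Exactness.accRate_le` (T2-E),
  `Theory2.sq_two_mul_tvDist_le`, `Theory2.one_sub_sqrt_le_accRate`, `Theory2.essFrac_mixLaw`
  (exact mixture ESS), `Theory2.essFrac_mixLaw_le`, `Theory2.acceptance_blind` (with
  `Theory2.essFrac_blockProd_of_pos`).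
evasions_known: none needed — report ESS/N, τ_int of the slowest sector observable and the sector
  histogram (FITNESS V8/V9); acceptance is then a free consistency check (a reported pair with
  `acc < 1 − √(1/ESS − 1)` is an analysis error, both being population values of the same `p, q`).
scope_caveats: stationary acceptance (chain started in `p`); finite state space; the window
  `[1 − 2TV, 1 − TV]` is sharp at both ends (disjoint supports / `q = p`).
status: PROVED (`acceptanceBlindness`). -/
def AcceptanceBlindness : Prop :=
  (∀ (X : Type) [Fintype X] [DecidableEq X] (p q : X → ℝ),
      (∀ x, 0 ≤ q x) → ∑ x, p x = 1 → ∑ x, q x = 1 →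
      Exactness.accRate p q = 1 - Literature.Probability.MarkovChains.tvDist
          (Theory2.prodLaw p q) (Theory2.prodLaw q p) ∧
      1 - 2 * Literature.Probability.MarkovChains.tvDist p q ≤ Exactness.accRate p q ∧
      Exactness.accRate p q ≤ 1 - Literature.Probability.MarkovChains.tvDist p q) ∧
  (∀ (X : Type) [Fintype X] [DecidableEq X] (p q : X → ℝ),
      (∀ x, 0 < q x) → ∑ x, p x = 1 → ∑ x, q x = 1 →
      (2 * Literature.Probability.MarkovChains.tvDist p q) ^ 2 ≤ (Theory2.essFrac p q)⁻¹ - 1 ∧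
      1 - Real.sqrt ((Theory2.essFrac p q)⁻¹ - 1) ≤ Exactness.accRate p q) ∧
  ∀ (m : ℕ) (Z : Type) [Fintype Z] (qb rb : Fin m → Z → ℝ) (θ : ℝ),
    (∀ i z, 0 < qb i z) → (∀ i, ∑ z, qb i z = 1) → (∀ i z, 0 ≤ rb i z) →
    (∀ i, ∑ z, rb i z = 1) → 0 < θ → θ ≤ 1 →
      1 - θ ≤ Exactness.accRate (Theory2.mixLaw θ (Theory2.blockProd qb) (Theory2.blockProd rb))
          (Theory2.blockProd qb) ∧
      Theory2.essFrac (Theory2.mixLaw θ (Theory2.blockProd qb) (Theory2.blockProd rb))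
          (Theory2.blockProd qb) ≤ θ⁻¹ ^ 2 * ∏ i, Theory2.essFrac (rb i) (qb i)

/-- The supplement `AcceptanceBlindness` is a theorem (discharged from the PROVED finite cores). [folklore] -/
theorem acceptanceBlindness : AcceptanceBlindness :=
  ⟨fun _ _ _ _ _ hq hp1 hq1 =>
      ⟨Theory2.accRate_eq_one_sub_tvDist_prodLaw hp1 hq1,
        Theory2.one_sub_two_tvDist_le_accRate hp1 hq hq1, Exactness.accRate_le hp1 hq1⟩,
    fun _ _ _ _ _ hq hp1 hq1 =>
      ⟨Theory2.sq_two_mul_tvDist_le hq hp1 hq1, Theory2.one_sub_sqrt_le_accRate hq hp1 hq1⟩,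
    fun _ _ _ _ _ _ hq hq1 hr hr1 hθ hθ1 => Theory2.acceptance_blind hq hq1 hr hr1 hθ hθ1⟩

/-- **Supplement (ReverseKLModeSeeking) to TopologicalModeCollapse — the training-side incentive,
quantified.**  For a sector-rescaled model `q = p · g∘π` (perfect inside each sector, sector
weights `p_k g_k`) the reverse KL (the self-sampled training loss), the forward KL and the
reweighting ESS all EQUAL their sector-level values; the reverse-KL cost of holding a sector of
true mass `a` at model mass `ε` is `binaryKL ε a ≤ −log(1−a)` nats (`≤ 0.223` for `a = 0.2`),
bounded as `ε → 0`, while the sampler-side prices are `ESS ≤ ε/a²` (every model, sharp event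
budget), forward KL `≥ a log(a/ε) + (1−a)log(1−a) → ∞`, and sector freezing for `≳ a/ε` sweeps
(T2-D, T2-R).  Hence any in-sector modelling error costing more than `−log(1−a)` nats of reverse
KL is profitably traded for dropping the sector: reverse-KL self-training is mode-SEEKING with a
computable exchange rate.
technique_class: reverse-KL (self-sampled) training of flows for multi-sector targets
  (topological charge sectors of 2-d U(1) / CP(N−1) / 4-d SU(N) at fine lattice spacing).
blocks: claims that a converged reverse-KL loss certifies sector coverage; loss-based early
  stopping as a mode-collapse diagnostic; "the loss plateaued at O(0.1) nats per configuration so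
  all sectors are represented".
because: PROVED `Theory2.klFin_rescaled_rev`, `Theory2.klFin_rescaled_fwd`,
  `Theory2.essFrac_rescaled` (equality cases of T2-P `Theory2.klFin_coarse_le` /
  `Theory2.essFrac_le_essFrac_coarse`), `Theory2.binaryKL_collapse_le`,
  `Theory2.binaryKL_collapse_ge`, `Theory2.essFrac_le_event_ratio`,
  `Theory2.binaryKL_event_le_klFin` (tree `binaryKL_le_sum_mul_log_div`).
evasions_known: forward-KL or mixed training on stored HMC configurations per sector
  [cite: NicoliEtAl2023, §IV]; sector-conditioned / defect-insertion flows [cite: HackettEtAl2024, §3 (defect-repair replica exchange)];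
  mode-dropping estimators that RESTORE exactness but pay the ESS price above
  [cite: NicoliEtAl2023].  All move the cost, none removes it: the sector weights must be learned
  or supplied (SectorWeightBudget).
scope_caveats: the exchange rate `−log(1−a)` is an UPPER bound on the minimal reverse-KL price (the
  optimiser may find cheaper partial collapses); finite state space; says nothing about SGD
  dynamics (conjecture C4 untouched).
status: PROVED (`reverseKLModeSeeking`). -/
def ReverseKLModeSeeking : Prop :=
  (∀ (X Y : Type) [Fintype X] [Fintype Y] [DecidableEq Y] (π : X → Y) (p : X → ℝ) (g : Y → ℝ),
      (∀ x, 0 < p x) → (∀ k, 0 < g k) → Function.Surjective π →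
      Theory2.klFin (fun x => p x * g (π x)) p =
          Theory2.klFin (Theory2.coarse π (fun x => p x * g (π x))) (Theory2.coarse π p) ∧
      Theory2.klFin p (fun x => p x * g (π x)) =
          Theory2.klFin (Theory2.coarse π p) (Theory2.coarse π (fun x => p x * g (π x))) ∧
      Theory2.essFrac p (fun x => p x * g (π x)) =
          Theory2.essFrac (Theory2.coarse π p) (Theory2.coarse π (fun x => p x * g (π x)))) ∧
  (∀ a ε : ℝ, 0 < ε → ε ≤ a → a < 1 →
      Literature.Probability.Entropy.binaryKL ε a ≤ -Real.log (1 - a) ∧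
      a * Real.log (a / ε) + (1 - a) * Real.log (1 - a) ≤
        Literature.Probability.Entropy.binaryKL a ε ∧
      (a ^ 2 / ε + (1 - a) ^ 2 / (1 - ε))⁻¹ ≤ ε / a ^ 2) ∧
  ∀ (X : Type) [Fintype X] (E : Finset X) (p q : X → ℝ), (∀ x, 0 < q x) → ∑ x, p x = 1 →
      0 < ∑ x ∈ E, p x → Theory2.essFrac p q ≤ (∑ x ∈ E, q x) / (∑ x ∈ E, p x) ^ 2

/-- The supplement `ReverseKLModeSeeking` is a theorem (discharged from the PROVED finite cores). [folklore] -/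
theorem reverseKLModeSeeking : ReverseKLModeSeeking :=
  ⟨fun _ _ _ _ _ π _ g hp hg hπ =>
      ⟨Theory2.klFin_rescaled_rev π g hp, Theory2.klFin_rescaled_fwd π g hp,
        Theory2.essFrac_rescaled π hp hg hπ⟩,
    fun a ε hε hεa ha1 =>
      ⟨Theory2.binaryKL_collapse_le hε hεa ha1,
        Theory2.binaryKL_collapse_ge hε.le (by linarith) ha1,
        Theory2.inv_twoSector_le hε (by linarith) (hε.trans_le hεa)⟩,
    fun _ _ E _ _ hq hp1 hpE => Theory2.essFrac_le_event_ratio E hq hp1 hpE⟩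

/-- **Supplement (ReceptiveFieldLaw) to VolumeScalingOfTraining — the receptive field of a
fixed-quality local flow must grow like `log V`.**  If the target's block marginals sit at total
variation `≥ κ e^{−s/ξ}` from every across-cut-independent law (T2-N: `κ = |⟨P;P⟩_c|`-amplitude/6,
`s` = cut width `= 2R+1` for receptive-field radius `R`, `ξ` the clustering length of
`Conjectures.ClusteringFloor`), then over `m` disjoint blocks `ESS ≥ η` forces
`s ≥ (ξ/2) log(2 m κ² / log(1/η))`; with `m ≍ V/(4R+2)^d` blocks this is
`R ≥ (d ξ/4) log L − O(ξ log R + ξ log(6/κ₀) + ξ log log(1/η))`.  Matching upper bound inside the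
strong-coupling disc: THEORY-1 THEOREM A (`Torus.locNorm_series_tail_le`): footprint `Θ(log V)`
suffices there.
technique_class: fixed-architecture local flows (masked coupling / CNN / finite-order trivializing
  maps) transferred or retrained across volumes with receptive field independent of `L`.
blocks: volume-transfer claims at fixed architecture depth; "train small, deploy large" cost models
  that keep the coupling-layer count fixed; conversely it BOUNDS the necessary growth: logarithmic,
  not power-law, receptive fields are what the volume law demands (multiscale / hierarchical
  architectures [cite: AbbottEtAl2024Multiscale] are the natural evasion).
because: PROVED `Theory2.receptiveField_log_volume_law` (from `Theory2.ess_blockDefect_volume_law`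
  T2-I″ = T2-I + T2-A, `Theory2.defectFromCorrelation` T2-N, light cone T2-L
  `Theory2.localPushforwardIndep`); clustering input `Conjectures.ClusteringFloor` (strong coupling:
  theorem by the cluster expansion [cite: OsterwalderSeiler1978]; intermediate β: conjecture in its
  L-uniformity only).
evasions_known: receptive field `∝ log V` (cost per layer `∝ V`, so total cost `∝ V log V` at fixed
  ESS — the law permits this); multiscale architectures; non-product priors (HMC-preconditioned /
  annealed flows — then `q` is not across-cut independent and the law prices only the residual).
scope_caveats: one-sided (necessary growth); `d ≥ 3` for the clustering floor as typed (2-d pure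
  gauge plaquettes are independent: no floor); constants not optimised; finite state space.
status: PROVED modulo the typed conjecture `Conjectures.ClusteringFloor` (`receptiveFieldLaw`). -/
def ReceptiveFieldLaw : Prop :=
  ∀ (m : ℕ) (Z : Type) [Fintype Z] [DecidableEq Z] (p : (Fin m → Z) → ℝ) (qb : Fin m → Z → ℝ)
    (κ ξ s η : ℝ), (∀ φ, 0 < p φ) → ∑ φ, p φ = 1 → (∀ i z, 0 < qb i z) → (∀ i, ∑ z, qb i z = 1) →
    0 < κ → 0 < ξ → 0 < η → η < 1 → 0 < m →
    (∀ i, κ * Real.exp (-(s / ξ)) ≤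
        Literature.Probability.MarkovChains.tvDist (Theory2.blockMarg p i) (qb i)) →
    η ≤ Theory2.essFrac p (Theory2.blockProd qb) →
      ξ / 2 * Real.log (2 * m * κ ^ 2 / Real.log η⁻¹) ≤ s

/-- The supplement `ReceptiveFieldLaw` is a theorem (discharged from the PROVED finite cores). [folklore] -/
theorem receptiveFieldLaw : ReceptiveFieldLaw :=
  fun _ _ _ _ _ _ _ _ _ _ hp hp1 hq hq1 hκ hξ hη hη1 hm hdef hess =>
    Theory2.receptiveField_log_volume_law hp hp1 hq hq1 hκ hξ hη hη1 hm hdef hess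

/-- **Supplement (RelaxationVolumeLaw) to VolumeScalingOfTraining / ExactnessVsExpressivity — the
exact chain's relaxation time from the worst configuration is the PRODUCT of the block envelopes.**
Product target `⊗pb`, product model `⊗qb`, `pb_i ≤ W_i qb_i` with equality at `x⋆_i`: the
independence-Metropolis chain started at `x⋆ = (x⋆_i)` satisfies
`‖δ_{x⋆}Pᵗ − ⊗pb‖_TV = (1 − (Π W_i)⁻¹)ᵗ (1 − ⊗pb(x⋆))` exactly, so `ε`-mixing needs
`t (1 − p⋆) ≥ (1 − p⋆ − ε) Π_i W_i` steps (`= W^m`, exponential in the volume, for identical blocks) — at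
ANY mean acceptance (AcceptanceBlindness) and even when `ESS` per block is close to `1`
(`W_i` is a sup, ESS an average).  The finite-state Mengersen–Tweedie–Liu–Wang theorem (tree:
`Literature.Probability.MarkovChains.imh_tvDist_lawAt_mode`; `imh_tvDist_lawAt_le`, matching upper
bound from every start) identifies `w⋆ = sup p/q = Π_i W_i` as THE relaxation time.
technique_class: full-lattice independence proposals (flow-MCMC) from a model with a pointwise
  under-weighted configuration per block — every imperfect local model transferred in volume.
blocks: worst-case (cold-start / rare-configuration) mixing claims uniform in `L`; using mean
  acceptance or stationary-start autocorrelations to bound relaxation from atypical starts.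
because: PROVED (row 31's `Scaling/IMHVolumeLaw.lean`) `Theory2.imh_blockProd_tvDist_mode` (the
  exact rate from the product mode, via `Literature.Probability.MarkovChains.imh_tvDist_lawAt_mode`),
  `Theory2.imh_blockProd_mixing_time_ge` (Bernoulli), `Theory2.blockProd_le_prod_mul_blockProd`,
  `Theory2.blockProd_eq_prod_mul_blockProd_of_modes`; matching upper bound
  `Theory2.imh_blockProd_tvDist_le`; identical blocks `Theory2.imh_blockProd_const_mixing_time_ge`
  (`W₁^m`).
evasions_known: sub-volume / local updates (the envelope then does not multiply across blocks:
  domain-decomposed flow proposals, HMC-flow hybrids); warm starts from `p` (the stationary chain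
  pays the AVERAGE budget T2-C/T2-R instead of the sup).
scope_caveats: worst-case start; product structure on both sides (the general statement is the
  tree's, with `w⋆ = sup p/q` whatever the structure); finite state space.
status: PROVED (`relaxationVolumeLaw`). -/
def RelaxationVolumeLaw : Prop :=
  ∀ (m : ℕ) (Z : Type) [Fintype Z] [DecidableEq Z] (pb qb : Fin m → Z → ℝ) (W : Fin m → ℝ)
    (xs : Fin m → Z) (t : ℕ) (ε : ℝ),
    (∀ i z, 0 < pb i z) → (∀ i, ∑ z, pb i z = 1) → (∀ i z, 0 ≤ qb i z) →
    (∀ i, ∑ z, qb i z = 1) → (∀ i z, pb i z ≤ W i * qb i z) →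
    (∀ i, pb i (xs i) = W i * qb i (xs i)) →
      Literature.Probability.MarkovChains.tvDist (Literature.Probability.MarkovChains.lawAt
          (Exactness.imhKernel (Theory2.blockProd pb) (Theory2.blockProd qb)) (Pi.single xs 1) t)
          (Theory2.blockProd pb) = (1 - (∏ i, W i)⁻¹) ^ t * (1 - ∏ i, pb i (xs i)) ∧
      (Literature.Probability.MarkovChains.tvDist (Literature.Probability.MarkovChains.lawAt
          (Exactness.imhKernel (Theory2.blockProd pb) (Theory2.blockProd qb)) (Pi.single xs 1) t)
          (Theory2.blockProd pb) ≤ ε → (∏ i, W i) * (1 - Theory2.blockProd pb xs - ε) ≤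
            t * (1 - Theory2.blockProd pb xs))

/-- The supplement `RelaxationVolumeLaw` is a theorem (discharged from the PROVED finite cores). [folklore] -/
theorem relaxationVolumeLaw : RelaxationVolumeLaw :=
  fun _ _ _ _ _ _ _ _ t _ hp hp1 hq hq1 hW hxs =>
    ⟨Theory2.imh_blockProd_tvDist_mode hp hp1 hq hq1 hW hxs t,
      fun h => Theory2.imh_blockProd_mixing_time_ge hp hp1 hq hq1 hW hxs h⟩

end Summit.Ventures.LatticeQCDFlow.Barriers
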